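import Summits.BirchSwinnertonDyer.Rank1Residual.X5.SelmerSolitaireExtend
import HarnessLib

/-!
# Selmer solitaire, QUADRATIC-SPACE LAYER (ii‴) — Q1: vocabulary QS0 and the word-shapes QS1–QS5

Cell `b2b-bsdres`, O1 programme (p = 2), ORDER v2.9 pool slot (ii‴) (o1 lead GEN 20, R-G20.3/R-G20.4,
PLAN C150), file Q1 of Q1 → Q2 → Q4 → Q5 (→ Q3, Q6, Q7); pool hand x11b3-p4 GEN 5. SPELLING OF RECORD =
lens-2 GEN 10's seat sketch `HOME/b2b-bsdres-o1-idea-2-g10/lean/O1Stub1QuadraticSketch.lean` (sha16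
3dc11828c23e4834; ROUTES-O1 §lens-2 GEN 10 ADDENDUM 2G10.2, l.1972), reproduced here VERBATIM (every
`def` below is byte-identical to the sketch in its BODY; only this header, the unit tests of §3 and the
docstring cite key `doi:10.1090/conm/358/06543` ↦ `MazurRubin2004Intro` (references.bib lint) are new).
Companion of `X5/SelmerSolitaire.lean` (p272248, the GRAPH layer: positions, cores as odd matching
counts, moves as one-vertex extensions); THIS file is the layer underneath it — totally singular
Lagrangians of the orthogonal sum `Q_D = P̄₂ ⊕ ⊕_{ℓ ∈ D} H_ℓ` of hyperbolic `𝔽₂`-planes with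
distinguished singular bases — in which lens-2's Propositions A/B/C and Theorems T1–T3 (GEN 5
G5.1–G5.3, GEN 7 (M3′)) are statements of PURE LINEAR ALGEBRA.

HONEST FRAMING (cell, verbatim): research route; everything in this file is a DEFINITION (the
vocabulary QS0) or a `def … : Prop` WORD-SHAPE (QS1–QS5: nothing asserted, no `sorry`, no axiom, no
named fact); pure `𝔽₂` linear algebra — no curve, no Galois group, no prime; the arithmetic dictionary
(AR1–AR4 of 2G10.3: the local quadratic spaces are `(H¹(ℚ_v, E[2]), q_v)` of Poonen–Rains, the
Lagrangian is the localisation image of the `D`-relaxed 2-Selmer group, a move is the adjunction of a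
Kolyvagin prime realising a functional) is NOT in this file and is NOT asserted anywhere;
reach-neutral (R1 closes no class); nothing booked; no mark / label / count moved; O1 OPEN.
Executable evidence for QS1–QS5 exactly as typed (lens-2 GEN 10, EVIDENCE only):
`HOME/b2b-bsdres-o1-idea-2-g10/code/qs_layer_check.py` (exhaustive |D| ≤ 3: 270 Lagrangians /
2 048 + 4 320 moves / 34 560 descent checks; sampled |D| = 4, 5; 0 violations).

Coordinates.  Vertices `V s = Option (Fin s)` (`none` = ∞ = the prime 2) as in `X5/SelmerSolitaire`.
A vector of `Q_D` has two coordinates at each vertex: at `some ℓ` the coefficients of `(u_ℓ, t_ℓ)`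
(unramified line, transverse line); at `none` the coefficients of `(w, w′)`, the two singular lines of
`P̄₂ = A^⊥/A`, `w = W₂/A` the Kummer line ((M3′)).  `q(x) = Σ_v x_v.1 * x_v.2`.

## Contents
* §1 QS0 vocabulary: `QVec`, `qform`, `polar`, `IsTSLagrangian`, `InLam`, `InLamStar`, `CoreQ`,
  `lineOf`, `lamCoord`, `nfVec`, `nfSpace`, `iota`, `uNew`, `psiN`, `kPrime`, `indic`.
* §2 the word-shapes QS1 `NormalForm`, QS1u `NormalFormUnique`, QS1c `CoreTest`, QS2a `MoveForced`,
  QS2b `MoveIsExtension`, QS3 `ParityLaw`, QS4 `InducedCube`, QS4′ `InducedCube'`, QS5 `DescentRule`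
  (reserved theorem names for the sequel files, cc-typer-4 countersign by silence per R-G20.3:
  `coreTest_holds` (Q2), `moveForced_holds` / `moveIsExtension_holds` (Q4), `inducedCube_holds` /
  `inducedCube'_holds` (Q5), `normalForm_holds` / `normalFormUnique_holds` (Q3), `descentRule_holds` (Q6)).
* §3 unit tests at `s ≤ 2` (`decide` / `simp` examples: the definitions compute as intended).

## References
* lens-2 GEN 5 (G5.1 Props A/B/C, G5.2 T3, G5.3 T1/T2), GEN 7 (M3′), GEN 10 (2G10.1–2G10.6),
  `cells/o1/ROUTES-O1.md`.
* B. Mazur, K. Rubin, *Kolyvagin systems*, Mem. AMS 799 (2004), §4.3; *Introduction to Kolyvagin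
  systems*, Contemp. Math. 358 (2004), Def. 4.2 (core vertices), Prop. 4.3, §5 (the graph `𝒳⁰`)
  [cite: MazurRubin2004Intro]. [MazurRubin2004]
* B. Poonen, E. Rains, *Random maximal isotropic subspaces and Selmer groups*, JAMS 25 (2012)
  = arXiv:1009.0287, §4 (Prop. 4.10, 4.12, Thm. 4.13). [PoonenRains2012]
* A. Bouchet, *Graphic presentations of isotropic systems*, JCTB 45 (1988) 58–76, Thm 4/5 (the board:
  `L_D` is an isotropic system; finding of record 2G10.4).

## Tree search (dedup, 2026-08-21)
`lean search 'QVec|qform|IsTSLagrangian|InLamStar|CoreQ|nfSpace|kPrime|psiN'` in `Summits/` → none;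
namespace `…X5.SelmerSolitaire.Quadratic` new; no (ii′) name re-declared (`extend`, `Position`, `V`,
`Core`, `lift` imported from `X5.SelmerSolitaire` / `X5.SelmerSolitaireExtend`).
-/

namespace Summit.BirchSwinnertonDyer.Rank1Residual.X5.SelmerSolitaire.Quadratic

open Finset SelmerSolitaire

variable {s : ℕ}

/-! ## QS0 vocabulary -/

/-- A vector of `Q_D` (`|D| = s`): two `𝔽₂`-coordinates per vertex of `V s = D ⊔ {∞}`. [folklore] -/
abbrev QVec (s : ℕ) := V s → ZMod 2 × ZMod 2

/-- The quadratic form `Q_D = q̄₂ + Σ_ℓ q_ℓ` in the singular bases: `q(a·u + b·t) = a·b` on each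
hyperbolic plane. [cite: PoonenRains2012, Prop. 4.10] -/
def qform (x : QVec s) : ZMod 2 := ∑ v, (x v).1 * (x v).2

/-- Its polar (alternating) form = the sum of the local Tate pairings. [cite: PoonenRains2012, §4] -/
def polar (x y : QVec s) : ZMod 2 := ∑ v, ((x v).1 * (y v).2 + (x v).2 * (y v).1)

/-- `U` is a totally `Q_D`-singular subspace of dimension `s + 1` (a totally singular Lagrangian).
[cite: PoonenRains2012, Thm. 4.13] -/
def IsTSLagrangian (U : Submodule (ZMod 2) (QVec s)) : Prop :=
  (∀ x ∈ U, qform x = 0) ∧ Module.finrank (ZMod 2) U = s + 1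

/-- `x ∈ Λ_n`: at `ℓ ∈ n` only the transverse coordinate, at `ℓ ∉ n` only the unramified coordinate
(no condition at `∞`).  `Λ_n` = the local conditions of `𝓕(n)` (relaxed at `2`). [cite: MazurRubin2004Intro, Def. 4.2] -/
def InLam (n : Finset (Fin s)) (x : QVec s) : Prop :=
  ∀ i : Fin s, (i ∈ n → (x (some i)).1 = 0) ∧ (i ∉ n → (x (some i)).2 = 0)

/-- `x ∈ Λ*_n`: as `Λ_n` and zero at `∞` (the dual structure `𝓕(n)*`, strict at `2`).
[cite: MazurRubin2004Intro, Def. 4.2] -/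
def InLamStar (n : Finset (Fin s)) (x : QVec s) : Prop :=
  x none = 0 ∧ InLam n x

/-- `n` is CORE for the Lagrangian `U`: `U ∩ Λ*_n = 0` (model form of `H¹_{𝓕(n)*}(ℚ, E[2]) = 0`,
Mazur–Rubin's `λ*(n) = 0`). [cite: MazurRubin2004Intro, Def. 4.2] -/
def CoreQ (U : Submodule (ZMod 2) (QVec s)) (n : Finset (Fin s)) : Prop :=
  ∀ x ∈ U, InLamStar n x → x = 0

/-- The singular line of `P̄₂` selected by a type bit: `false ↦ w = (1,0)` (Kummer), `true ↦ w′ = (0,1)`.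
[folklore] -/
def lineOf (b : Bool) : ZMod 2 × ZMod 2 := if b then (0, 1) else (1, 0)

/-- The `λ`-coordinate of a vector of `P̄₂` for the type bit `b` (coefficient of `lineOf b`). [folklore] -/
def lamCoord (b : Bool) (p : ZMod 2 × ZMod 2) : ZMod 2 := if b then p.2 else p.1

/-- T3's explicit vector of the position `P` with type bit `b` attached to `(ε, z) ∈ 𝔽₂ × 𝔽₂^D`:
at `∞`: `ε·λ + (σ·z)·λ′`; at `ℓ`: `u`-coordinate `(S z + ε σ)_ℓ`, `t`-coordinate `z_ℓ`
(`σ_ℓ = Ŝ(ℓ, ∞)`, `S = Ŝ|_D`). (lens-2 G5.2, T3.) [folklore] -/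
def nfVec (P : Position s) (b : Bool) (ε : ZMod 2) (z : Fin s → ZMod 2) : QVec s := fun v =>
  match v with
  | none => ε • lineOf b + (∑ l, P.S (some l) none * z l) • lineOf (!b)
  | some l => ((∑ l', P.S (some l) (some l') * z l') + ε * P.S (some l) none, z l)

/-- The subspace `𝒰(P, b)` in T3 normal form (span of the explicit vectors; they already form a
subspace). (lens-2 G5.2.) [folklore] -/
def nfSpace (P : Position s) (b : Bool) : Submodule (ZMod 2) (QVec s) :=
  Submodule.span (ZMod 2) {x | ∃ ε z, x = nfVec P b ε z}

/-- Embedding `Q_D ↪ Q_{D ∪ {q}}` (zero at the new vertex `q = some (Fin.last s)`). [folklore] -/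
def iota (x : QVec s) : QVec (s + 1) := fun v =>
  match v with
  | none => x none
  | some l => Fin.lastCases (0, 0) (fun i => x (some i)) l

/-- The unramified vector `u_q` at the new vertex. [folklore] -/
def uNew (s : ℕ) : QVec (s + 1) := Pi.single (some (Fin.last s)) (1, 0)

/-- The functional `ψ_N` on `Q_D` attached to a neighbourhood `N ⊆ D ⊔ {∞}` (for the type bit `b`):
`ψ_N(x) = Σ_{ℓ ∈ N ∩ D} t_ℓ(x) + [∞ ∈ N]·λ(x)` — the functional a new prime `q ~ N` realises
(`loc_q = ψ_N · u_q`). (lens-2 G5.2 T3 (ii).) [folklore] -/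
def psiN (b : Bool) (N : Finset (V s)) (x : QVec s) : ZMod 2 :=
  (∑ l, if some l ∈ N then (x (some l)).2 else 0) + if none ∈ N then lamCoord b (x none) else 0

/-- `K′_ψ = {ι x + ψ(x)·u_q : x ∈ U}` — the old classes seen at the level `D ∪ {q}`. (lens-2 G5.1 Prop B.)
[folklore] -/
def kPrime (U : Submodule (ZMod 2) (QVec s)) (ψ : QVec s → ZMod 2) : Set (QVec (s + 1)) :=
  {y | ∃ x ∈ U, y = iota x + ψ x • uNew s}

/-- The neighbourhood indicator of a finset of old vertices (input format of `extend`). [folklore] -/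
def indic (N : Finset (V s)) : V s → ZMod 2 := fun v => if v ∈ N then 1 else 0

/-! ## QS1–QS5: the statements (all `Prop`s; proved nowhere in the tree yet) -/

/-- **QS1 (NORMAL FORM, T3)**: every totally singular Lagrangian with `∅` core is `𝒰(P, b)` for a
position `P` (a simple graph on `D ⊔ {∞}`) and a type bit `b`. (lens-2 G5.2; exec-verified |D| ≤ 3
exhaustively.) [folklore] -/
def NormalForm : Prop :=
  ∀ (s : ℕ) (U : Submodule (ZMod 2) (QVec s)), IsTSLagrangian U → CoreQ U ∅ →
    ∃ (P : Position s) (b : Bool), U = nfSpace P b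

/-- **QS1u (uniqueness of the normal form)**. [folklore] -/
def NormalFormUnique : Prop :=
  ∀ (s : ℕ) (P P' : Position s) (b b' : Bool), nfSpace P b = nfSpace P' b' → P = P' ∧ b = b'

/-- **QS1c (CORE TEST, T3 (i))**: in normal form, `n` is core iff `det Ŝ[n⁺] = 1` (odd number of
perfect matchings of `Γ̂[n⁺]`), i.e. iff `Core P n` of `X5/SelmerSolitaire`; and `𝒰(P, b)` is a
totally singular Lagrangian. (lens-2 G5.2; exec 1 024 / 1 024 core tests at |D| = 3.) [folklore] -/
def CoreTest : Prop :=
  ∀ (s : ℕ) (P : Position s) (b : Bool),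
    IsTSLagrangian (nfSpace P b) ∧ ∀ n : Finset (Fin s), CoreQ (nfSpace P b) n ↔ Core P n

/-- **QS2a (THE MOVE EXISTS AND IS FORCED, Prop B)**: for every totally singular Lagrangian `U` of
`Q_D` and every linear functional `ψ` on it, among the totally singular Lagrangians of `Q_{D ∪ q}`
containing `K′_ψ` there is EXACTLY ONE not containing `u_q`.  (Arithmetic reading: `K_D = 0` excludes
`u_q`, so the localisation image at level `D ∪ q` is determined by `ψ = loc_q|`.) (lens-2 G5.1 Prop B;
exec 4 320 / 4 320 at |D| = 3.) [folklore] -/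
def MoveForced : Prop :=
  ∀ (s : ℕ) (U : Submodule (ZMod 2) (QVec s)) (ψ : QVec s →ₗ[ZMod 2] ZMod 2), IsTSLagrangian U →
    ∃! L : Submodule (ZMod 2) (QVec (s + 1)),
      IsTSLagrangian L ∧ kPrime U ψ ⊆ (L : Set (QVec (s + 1))) ∧ uNew s ∉ L

/-- **QS2b (A MOVE ADDS ONE VERTEX, T3 (ii) / Prop C)**: in normal form, the forced Lagrangian of the
move by `ψ_N` is the normal form of the ONE-VERTEX EXTENSION `extend P N` (new vertex `q ~ N`), same
type bit. (lens-2 G5.2 T3 (ii); exec 2 048 / 2 048 at |D| = 3.) [folklore] -/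
def MoveIsExtension : Prop :=
  ∀ (s : ℕ) (P : Position s) (b : Bool) (N : Finset (V s)) (L : Submodule (ZMod 2) (QVec (s + 1))),
    IsTSLagrangian L → kPrime (nfSpace P b) (psiN b N) ⊆ (L : Set (QVec (s + 1))) → uNew s ∉ L →
    L = nfSpace (extend P (indic N)) b

/-- **QS3 (PARITY / TYPE LAW, T1)** — a law, not load-bearing for R1: for core `n` the generator of
`U ∩ Λ_n` has `∞`-part `w` or `w′` (never `0`, never `w + w′`), and `type(n) + |n|` is constant on the
core set. (lens-2 G5.3 T1; exec.) [folklore] -/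
def ParityLaw : Prop :=
  ∀ (s : ℕ) (U : Submodule (ZMod 2) (QVec s)), IsTSLagrangian U →
    ∃ c : ZMod 2, ∀ (n : Finset (Fin s)) (x : QVec s), CoreQ U n → x ∈ U → InLam n x → x ≠ 0 →
      ∃ b : Bool, x none = lineOf b ∧ (if b then 1 else 0) + (n.card : ZMod 2) = c

/-- **QS4 (INDUCED CUBE, T2; uses `dim P̄₂ = 2`, i.e. (M3′))**: if `n` and `n ∪ {ℓ}` are both core then
the generator `c_n` of `U ∩ Λ_n` has `u_ℓ`-coordinate `1` — cube-adjacent core vertices are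
`𝒳⁰`-adjacent (`loc_ℓ c_n ≠ 0`), so `CubeAdj` of `X5/SelmerSolitaire` IS Mazur–Rubin's edge relation.
(lens-2 G5.3 T2; exec 768 / 768 adjacent core pairs at |D| = 3.) [cite: MazurRubin2004Intro, §5 (𝒳⁰)] -/
def InducedCube : Prop :=
  ∀ (s : ℕ) (U : Submodule (ZMod 2) (QVec s)) (n : Finset (Fin s)) (l : Fin s) (x : QVec s),
    IsTSLagrangian U → l ∉ n → CoreQ U n → CoreQ U (insert l n) → x ∈ U → InLam n x → x ≠ 0 →
    (x (some l)).1 = 1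

/-- **QS4′ (INDUCED CUBE, second half)**: symmetrically the generator `c_{n ∪ ℓ}` of `U ∩ Λ_{n ∪ ℓ}` has
`t_ℓ`-coordinate `1` (`loc_ℓ c_{nℓ}` spans the transverse = singular quotient), which is the other
isomorphism in Mazur–Rubin's definition of an `𝒳⁰`-edge. (exec 768 / 768 at |D| = 3.)
[cite: MazurRubin2004Intro, §5 (𝒳⁰)] -/
def InducedCube' : Prop :=
  ∀ (s : ℕ) (U : Submodule (ZMod 2) (QVec s)) (n : Finset (Fin s)) (l : Fin s) (x : QVec s),
    IsTSLagrangian U → l ∉ n → CoreQ U n → CoreQ U (insert l n) → x ∈ U → InLam (insert l n) x →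
    x ≠ 0 → (x (some l)).2 = 1

/-- **QS5 (DESCENT RULE, Mazur–Rubin Prop. 4.3 shape)**: if `ψ ≠ 0` on `U ∩ Λ*_n` then after the move
by `ψ` the vertex `n ∪ {q}` has `dim (L ∩ Λ*_{n ∪ q}) = dim (U ∩ Λ*_n) - 1`; stated without `finrank`:
every element of `L ∩ Λ*_{n ∪ q}` is `ι y (+ 0·u_q)` for a `y ∈ U ∩ Λ*_n` with `ψ y = 0`.  Hence (with
AR4) `λ*` can always be lowered to `0`: core vertices exist (AR0). (exec 10 080 / 10 080 cases at
|D| = 3, together with the `0` / `+1` cases of the trichotomy.) [cite: MazurRubin2004Intro, Prop. 4.3 (ii)] -/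
def DescentRule : Prop :=
  ∀ (s : ℕ) (U : Submodule (ZMod 2) (QVec s)) (ψ : QVec s →ₗ[ZMod 2] ZMod 2) (n : Finset (Fin s))
    (L : Submodule (ZMod 2) (QVec (s + 1))),
    IsTSLagrangian U → IsTSLagrangian L → kPrime U ψ ⊆ (L : Set (QVec (s + 1))) → uNew s ∉ L →
    (∃ x ∈ U, InLamStar n x ∧ ψ x ≠ 0) →
    ∀ y ∈ L, InLamStar (insert (Fin.last s) (lift n)) y → ∃ x ∈ U, InLamStar n x ∧ ψ x = 0 ∧ y = iota x

/-! ## §3 Unit tests at `s ≤ 2` (the definitions compute as intended; lens-2's sketch sanity checks first) -/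

section UnitTests

/-- Sanity (definitions compute): the zero vector is `Q`-singular. [folklore] -/
example : qform (0 : QVec 2) = 0 := by simp [qform]

/-- Sanity: `u_q` is `Q`-singular and `∞`-free. [folklore] -/
example : qform (uNew 1) = 0 ∧ (uNew 1) none = 0 := by
  refine ⟨?_, ?_⟩ <;> simp [qform, uNew, Pi.single_apply]

/-- `q` is genuinely quadratic: `q(u_ℓ + t_ℓ) = 1` on one hyperbolic plane (`s = 1`, vertex `ℓ`).
[folklore] -/
example : qform (Pi.single (some (0 : Fin 1)) ((1, 1) : ZMod 2 × ZMod 2) : QVec 1) = 1 := by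
  simp [qform, Pi.single_apply]

/-- The polar form pairs the two singular lines of a plane to `1`: `⟨w, w′⟩ = 1` at `∞` (`s = 0`).
[folklore] -/
example : polar (fun _ => lineOf false : QVec 0) (fun _ => lineOf true) = 1 := by
  simp [polar, lineOf]

/-- `lamCoord b` reads the coefficient of `lineOf b`: `lamCoord b (lineOf b) = 1`,
`lamCoord b (lineOf !b) = 0`. [folklore] -/
example : ∀ b : Bool, lamCoord b (lineOf b) = 1 ∧ lamCoord b (lineOf (!b)) = 0 := by decide

/-- `Λ*_n` is strict at `∞`: `u_∞`-type vectors are not in `Λ*_∅` (`s = 0`). [folklore] -/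
example : ¬ InLamStar (∅ : Finset (Fin 0)) (fun _ => lineOf false : QVec 0) := by
  simp [InLamStar, lineOf]

/-- `Λ_n` at `s = 1`: the transverse vector `t_ℓ` lies in `Λ_{{ℓ}}` and not in `Λ_∅`. [folklore] -/
example : InLam ({0} : Finset (Fin 1)) (Pi.single (some (0 : Fin 1)) ((0, 1) : ZMod 2 × ZMod 2)) ∧
    ¬ InLam (∅ : Finset (Fin 1)) (Pi.single (some (0 : Fin 1)) ((0, 1) : ZMod 2 × ZMod 2)) := by
  refine ⟨fun i => ?_, fun h => ?_⟩
  · fin_cases i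
    simp
  · simpa [Pi.single_apply] using (h 0).2

/-- The zero Lagrangian-candidate `⊥` has every vertex core (vacuously: `CoreQ` only asks
`U ∩ Λ*_n = 0`). [folklore] -/
example (n : Finset (Fin 2)) : CoreQ (⊥ : Submodule (ZMod 2) (QVec 2)) n := fun _ hx _ =>
  (Submodule.mem_bot (R := ZMod 2)).mp hx

/-- `ι` is zero at the new vertex and the identity at `∞` (`s = 1 → 2`). [folklore] -/
example (x : QVec 1) : iota x (some (Fin.last 1)) = 0 ∧ iota x none = x none := by
  refine ⟨?_, rfl⟩
  simp [iota]
  rfl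

/-- `ι` copies the old vertices: `(ι x)(some (castSucc i)) = x (some i)` (`s = 1 → 2`). [folklore] -/
example (x : QVec 1) (i : Fin 1) : iota x (some (Fin.castSucc i)) = x (some i) := by
  simp [iota, Fin.lastCases_castSucc]

/-- The neighbourhood indicator is the input format of `extend`: `indic {∞} ∞ = 1`, `indic {∞} ℓ = 0`
(`s = 1`). [folklore] -/
example : indic ({none} : Finset (V 1)) none = 1 ∧ indic ({none} : Finset (V 1)) (some 0) = 0 := by
  simp [indic]

/-- `ψ_N` for `N = {∞}` reads the `λ`-coordinate: on `w = lineOf false` with type bit `false` it is `1`,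
with type bit `true` it is `0` (`s = 0`). [folklore] -/
example : psiN false ({none} : Finset (V 0)) (fun _ => lineOf false) = 1 ∧
    psiN true ({none} : Finset (V 0)) (fun _ => lineOf false) = 0 := by
  simp [psiN, lamCoord, lineOf]

/-- `ψ_N` for `N = {ℓ}` reads the transverse coordinate `t_ℓ` (`s = 1`). [folklore] -/
example : psiN false ({some 0} : Finset (V 1)) (Pi.single (some (0 : Fin 1)) ((0, 1) : ZMod 2 × ZMod 2)) = 1 := by
  simp [psiN, Pi.single_apply]

/-- T3's vector at `D = ∅` (`s = 0`, the base position): `nfVec P b ε 0` at `∞` is `ε • lineOf b` —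
the class `c_∅` has `∞`-part `w` or `w′` according to the type bit (QS3's shape). [folklore] -/
example (P : Position 0) (b : Bool) : nfVec P b 1 (fun _ => 0) none = lineOf b := by
  simp [nfVec]

/-- `u_q ∈ K′_ψ` never comes from `x = 0`: the `K′`-vector of `0` is `0` (`s = 1`). [folklore] -/
example (U : Submodule (ZMod 2) (QVec 1)) (ψ : QVec 1 →ₗ[ZMod 2] ZMod 2) :
    (0 : QVec 2) ∈ kPrime U ψ := by
  refine ⟨0, U.zero_mem, ?_⟩
  rw [map_zero, zero_smul, add_zero]
  funext v
  rcases v with _ | l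
  · rfl
  · induction l using Fin.lastCases with
    | last => simp only [iota, Fin.lastCases_last]; rfl
    | cast i => simp only [iota, Fin.lastCases_castSucc]; rfl

end UnitTests

end Summit.BirchSwinnertonDyer.Rank1Residual.X5.SelmerSolitaire.Quadratic
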